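import Summits.SmoothPoincare4.SmoothPoincare4.Theorems.NormalFormStablyTrivial.Negative.TripleLoadBearing

/-!
# STRATEGY CENSUS — typed companions (crux `NormalFormStablyTrivial`, stmt-SmoothPoincare4-14591)

Signatures for the STRENGTHEN / DECOMPOSITION entries of `STRATEGY-CENSUS.md` (strategist
planner-cstrat-stmt-SmoothPoincare4-14591-0, 2026-08-16), each with the one-line logical relation to the crux
proved, so that the census's "buys nothing / remains the whole crux" verdicts are about statements that elaborate.
-/

set_option linter.dupNamespace false

noncomputable section

namespace Summit.SmoothPoincare4.SmoothPoincare4.Cruxes.NormalFormStablyTrivial.StrategyCensus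

open Literature.Topology.FourManifolds Subgroup
open Summit.SmoothPoincare4.SmoothPoincare4.Theses.CongruenceShadows
  (NormalFormStablyTrivial ShadowsStandard ShadowApproximation)
open Summit.SmoothPoincare4.SmoothPoincare4.Theorems.NormalFormStablyTrivial.Negative (PairsStandard)
open Summit.SmoothPoincare4.SmoothPoincare4.Theorems.AgkCor6Sufficiency.Negative (isStablyTrivial_cast_iff)

abbrev S (m : ℕ) : Type := SurfaceGroup (3 + 3 * m)
abbrev N (m : ℕ) : TrisectionKernels (3 + 3 * m) := s4Kernels.stabilizeIter m

/-! ## STRENGTHEN -/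

/-- **S⁺₁ (unstable normal form)**: every normalised `(3+3m, m+1)` trisection of `{1}` is `Iso` to the standard one AT ITS
OWN GENUS (= `ShadowApproximation` without the shadow hypothesis = SPC4_g ∧ balanced 4-d Waldhausen_g at every genus). -/
def UnstableNormalForm : Prop :=
  ∀ (m : ℕ) (K : TrisectionKernels (3 + 3 * m)),
    IsGroupTrisection (3 + 3 * m) (m + 1) (PUnit : Type) K → PairsStandard m K → TrisectionKernels.Iso (N m) K

/-- S⁺₁ ⇒ crux (n = 0), the proof of `GateLogic` verbatim. -/
theorem crux_of_unstable (h : UnstableNormalForm) : NormalFormStablyTrivial := by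
  intro m K hK hP
  obtain ⟨α, hα⟩ := h m K hK hP
  refine ⟨0, m, rfl, α.symm, fun i => ?_⟩
  have hcomp : α.symm.toMonoidHom.comp α.toMonoidHom = MonoidHom.id _ :=
    MonoidHom.ext fun γ => by simp
  change (K i).map α.symm.toMonoidHom = s4Kernels.stabilizeIter m i
  rw [← hα i, Subgroup.map_map, hcomp, Subgroup.map_id]

/-- **S⁺₂ (uniform stabilisation bound)**: one function `f` bounds, for every level `m`, the number of stabilisations
after which every normalised trisection of `{1}` is isomorphic to the standard triple. -/
def UniformBound : Prop :=
  ∃ f : ℕ → ℕ, ∀ (m : ℕ) (K : TrisectionKernels (3 + 3 * m)),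
    IsGroupTrisection (3 + 3 * m) (m + 1) (PUnit : Type) K → PairsStandard m K →
    ∃ h : 3 + 3 * (m + f m) = 3 + 3 * m + 3 * f m,
      TrisectionKernels.Iso (K.stabilizeIter (f m)) ((N (m + f m)).cast h)

/-- S⁺₂ ⇒ crux (take `n = f m`). -/
theorem crux_of_uniformBound (h : UniformBound) : NormalFormStablyTrivial := by
  obtain ⟨f, hf⟩ := h
  intro m K hK hP
  obtain ⟨h, hiso⟩ := hf m K hK hP
  exact ⟨f m, m + f m, h, hiso⟩

/-- **S⁺₃ (homotopy-type rigidity, the natural "classification" strengthening)**: any two `(g,k)` group trisections of the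
trivial group are stably isomorphic.  FALSE for two independent reasons recorded in the census (different intersection
forms at the same `(g,k)`, e.g. the `(2;0)` trisections of `S²×S²` and `ℂP² # ℂP²`; and, within one intersection form,
exotic pairs — Donaldson/Friedman–Morgan — since stable `Iso` implies diffeomorphism by Gay–Kirby). Typed only to pin the
statement; not claimed. -/
def HomotopyTypeRigidity : Prop :=
  ∀ (g k : ℕ) (K K' : TrisectionKernels g),
    IsGroupTrisection g k (PUnit : Type) K → IsGroupTrisection g k (PUnit : Type) K' →
    ∃ n : ℕ, TrisectionKernels.Iso (K.stabilizeIter n) (K'.stabilizeIter n)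

/-! ## DECOMPOSITION -/

/-- **D3 — stable shadow approximation** (the `--restate` of crux `ShadowApproximation` foreseen by the route's kill
criteria): a normalised trisection of `{1}` all of whose characteristic finite shadows are standard is STABLY trivial
(conclusion `IsStablyTrivial` instead of `Iso N K`).  Evades the judge's key risk (a shadow-standard NON-standard
trisection of `S⁴` refutes `ShadowApproximation`, not this: trisections of `S⁴` are stably standard, Gay–Kirby). -/
def StableShadowApproximation : Prop :=
  ∀ (m : ℕ) (K : TrisectionKernels (3 + 3 * m)),
    IsGroupTrisection (3 + 3 * m) (m + 1) (PUnit : Type) K → PairsStandard m K →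
    (∀ M : Subgroup (S m), M.Characteristic → M.FiniteIndex →
      ∃ ψ : S m ≃* S m, ∀ i : Fin 3, (N m i ⊔ M).map ψ.toMonoidHom = K i ⊔ M) →
    K.IsStablyTrivial

/-- the stable gate: `ShadowsStandard → StableShadowApproximation → crux` (pure logic). -/
theorem crux_of_stableGate (hS : ShadowsStandard) (hA : StableShadowApproximation) : NormalFormStablyTrivial :=
  fun m K hK hP => hA m K hK hP (hS m K hK)

/-- conversely the crux implies the stable approximation half outright (drop the shadow hypothesis): so, GIVEN the
BLIND half `ShadowsStandard`, `StableShadowApproximation` is EQUIVALENT to the crux — the piece that remains the whole crux. -/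
theorem stableShadowApproximation_of_crux (h : NormalFormStablyTrivial) : StableShadowApproximation :=
  fun m K hK hP _ => h m K hK hP

/-- `ShadowApproximation` (unstable, the route's rank-5 crux) ⇒ its stable restate. -/
theorem stableShadowApproximation_of_unstable (h : ShadowApproximation) : StableShadowApproximation := by
  intro m K hK hP hM
  obtain ⟨α, hα⟩ := h m K hK hP hM
  refine ⟨0, m, rfl, α.symm, fun i => ?_⟩
  have hcomp : α.symm.toMonoidHom.comp α.toMonoidHom = MonoidHom.id _ :=
    MonoidHom.ext fun γ => by simp
  change (K i).map α.symm.toMonoidHom = s4Kernels.stabilizeIter m i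
  rw [← hα i, Subgroup.map_map, hcomp, Subgroup.map_id]

/-- **D5 — the genus-3 rung** (`m = 0` slice; Meier's genus-3 conjecture ∩ {1}, stably): a COROLLARY of the crux at any
single higher level (level descent, Disproof §7 / `level_down_of_waldhausenPairs` p127259), hence the weakest instance —
a calibration target, not a piece of a decomposition. -/
def GenusThreeRung : Prop :=
  ∀ K : TrisectionKernels 3, IsGroupTrisection 3 1 (PUnit : Type) K → PairsStandard 0 K → K.IsStablyTrivial

theorem genusThreeRung_of_crux (h : NormalFormStablyTrivial) : GenusThreeRung :=
  fun K hK hP => h 0 K hK hP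

end Summit.SmoothPoincare4.SmoothPoincare4.Cruxes.NormalFormStablyTrivial.StrategyCensus

end
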